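import Summits.AtomisticToContinuum.BoseEinsteinCondensation.Theorems.InsertionFieldDelocalisation.Negative.Toolkit
import Summits.AtomisticToContinuum.BoseEinsteinCondensation.Theorems.InsertionFieldDelocalisation.Negative.PerronExistence
import HarnessLib

/-!
# Negative lemmas for crux `InsertionFieldDelocalisation` (stmt-AtomisticToContinuum-9673), III:
tightness of the constant

Supports (does not close) stmt-AtomisticToContinuum-9673, route `BECStronglyRayleigh`.

* `K1_floor` : `2‖r‖² ≤ #supp(r) · ‖r‖²Φ(r)` for `r ≥ 0` (Cauchy–Schwarz twice; flat fields are the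
  minimisers of the crux functional); `K1_floor_field` : `supp r^T ⊆ Tᶜ`, so
  `2‖r^T‖² ≤ (|Λ| - |T|) ‖r^T‖²Φ_T`.
* `const_lower_bound` : an admissible constant has `2L³ ≤ (L³-N+2)·M` whenever the `ω`-weights of the
  datum are not all zero; `sum_K1rhs_pos` : for a nonzero nonnegative sector vector they never are.
* `four_le_const` : `InsertionFieldDelocalisationAt M → 4 ≤ M` (unconditional, via the Perron existence
  of `PerronExistence.lean` at half filling on even tori, where the floor is `4L³/(L³+4)`). So no
  constant below `4` can work, the coherence constant the route can deliver is `c = 1/max(M,1) ≤ ¼`, and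
  `not_insertionFieldDelocalisationAt_of_lt_four` : every strengthening of the crux to an explicit
  constant `M < 4` (e.g. the flat-field value `2`) is FALSE.
* `K1_ceiling` / `K1Ineq_two_mul_cube` / `insertionFieldDelocalisation_bounded_sides` : the trivial
  ceiling `‖r‖²Φ ≤ 2‖r‖²` — at each fixed `L` the inequality holds with `M = 2L³` for every nonnegative
  vector, so every restriction of the crux to bounded sides is TRUE; only `L → ∞` is at stake.
-/

noncomputable section

namespace Summit.AtomisticToContinuum.BoseEinsteinCondensation.Theorems.InsertionFieldDelocalisation.Negative

open scoped BigOperators ComplexOrder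
open Literature.MathematicalPhysics.QuantumLattice Literature.Probability.LatticeModels Matrix Finset
open Summit.AtomisticToContinuum.BoseEinsteinCondensation.Theses.BECStronglyRayleigh

/-! ### (b) Tightness: the Cauchy–Schwarz floor and the necessary size of the constant

`‖r‖²Φ(r) ≥ 2‖r‖⁴/(Σr)² ≥ 2‖r‖²/#supp r` for every nonnegative `r` (flat fields are the minimisers),
and `supp r^T ⊆ Tᶜ` has `L³ - N + 2` sites; hence the `ω`-average of `L³Φ_T` is at least
`2L³/(L³ - N + 2)`, which tends to `4` at half filling: **no constant `M < 4` can work**, and the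
route's `c = 1/max(M,1)` is at most `¼`. -/

section Tightness

variable {ι : Type*} [Fintype ι]

/-- Chebyshev/Cauchy–Schwarz: `(Σ r²)² ≤ (Σ r)(Σ r³)` for `r ≥ 0`. [folklore] -/
theorem sq_sum_sq_le_sum_mul_sum_cube (r : ι → ℝ) (hr : ∀ i, 0 ≤ r i) :
    (∑ i, r i ^ 2) ^ 2 ≤ (∑ i, r i) * ∑ i, r i ^ 3 := by
  have h := Finset.sum_mul_sq_le_sq_mul_sq Finset.univ (fun i => Real.sqrt (r i))
    (fun i => r i * Real.sqrt (r i))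
  have h1 : ∀ i, Real.sqrt (r i) * (r i * Real.sqrt (r i)) = r i ^ 2 := fun i => by
    rw [mul_left_comm, ← pow_two, Real.sq_sqrt (hr i), pow_two]
  have h2 : ∀ i, Real.sqrt (r i) ^ 2 = r i := fun i => Real.sq_sqrt (hr i)
  have h3 : ∀ i, (r i * Real.sqrt (r i)) ^ 2 = r i ^ 3 := fun i => by
    rw [mul_pow, Real.sq_sqrt (hr i)]; ring
  simp only [h1, h2, h3] at h
  exact h

/-- **The Cauchy–Schwarz floor.** For a nonnegative vector `r` supported in a nonempty set `K`,
`2‖r‖² ≤ #K · ‖r‖²Φ(r)`, i.e. `Φ(r) ≥ 2/#K` with equality iff `r` is flat on `K`: the flat field is the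
minimiser of the crux functional. (Lean: both sides are `0` when `r ≡ 0`, matching `x/0 = 0`.)
[folklore] -/
theorem K1_floor (r : ι → ℝ) (hr : ∀ i, 0 ≤ r i) (K : Finset ι) (hK : ∀ i, i ∉ K → r i = 0) :
    2 * K1rhs r ≤ (K.card : ℝ) * K1lhs r := by
  have hsum_eq : ∀ f : ι → ℝ, (∀ i, i ∉ K → f i = 0) → ∑ i, f i = ∑ i ∈ K, f i := by
    intro f hf
    rw [← Finset.sum_subset (Finset.subset_univ K)]
    intro i _ hi
    exact hf i hi
  by_cases hR : ∑ i, r i = 0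
  · -- `r ≡ 0`
    have h0 : ∀ i, r i = 0 := fun i =>
      (Finset.sum_eq_zero_iff_of_nonneg fun j _ => hr j).mp hR i (Finset.mem_univ i)
    simp [K1rhs, K1lhs, h0]
  have hRpos : 0 < ∑ i, r i := lt_of_le_of_ne (Finset.sum_nonneg fun i _ => hr i) (Ne.symm hR)
  have hS2 : 0 ≤ ∑ i, r i ^ 2 := Finset.sum_nonneg fun i _ => sq_nonneg (r i)
  -- (i) `(Σr²)² ≤ (Σr)(Σr³)` ⇒ `Σr³/Σr ≥ (Σr²)²/(Σr)²`
  have hi : (∑ i, r i ^ 2) ^ 2 / (∑ i, r i) ^ 2 ≤ (∑ i, r i ^ 3) / ∑ i, r i := by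
    rw [div_le_div_iff₀ (by positivity) hRpos]
    calc (∑ i, r i ^ 2) ^ 2 * ∑ i, r i ≤ ((∑ i, r i) * ∑ i, r i ^ 3) * ∑ i, r i :=
          mul_le_mul_of_nonneg_right (sq_sum_sq_le_sum_mul_sum_cube r hr) hRpos.le
      _ = (∑ i, r i ^ 3) * (∑ i, r i) ^ 2 := by ring
  -- (ii) `(Σr)² ≤ #K · Σr²`
  have hii : (∑ i, r i) ^ 2 ≤ (K.card : ℝ) * ∑ i, r i ^ 2 := by
    rw [hsum_eq r hK, hsum_eq (fun i => r i ^ 2) fun i hi => by rw [hK i hi]; ring]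
    exact sq_sum_le_card_mul_sum_sq
  -- combine
  have hK0 : (0 : ℝ) < K.card := by
    have : (0 : ℝ) < (∑ i, r i) ^ 2 := by positivity
    have h := this.trans_le hii
    by_contra hle
    push Not at hle
    have : (K.card : ℝ) * ∑ i, r i ^ 2 ≤ 0 := mul_nonpos_of_nonpos_of_nonneg hle hS2
    linarith
  rw [K1rhs, K1lhs]
  have hmain : 2 * ((∑ i, r i ^ 2) ^ 2 / (∑ i, r i) ^ 2) ≤
      (∑ i, r i ^ 3) / (∑ i, r i) + (∑ i, r i ^ 2) ^ 2 / (∑ i, r i) ^ 2 := by linarith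
  have hfrac : (∑ i, r i ^ 2) / (K.card : ℝ) ≤ (∑ i, r i ^ 2) ^ 2 / (∑ i, r i) ^ 2 := by
    rw [div_le_div_iff₀ hK0 (by positivity)]
    calc (∑ i, r i ^ 2) * (∑ i, r i) ^ 2 ≤ (∑ i, r i ^ 2) * ((K.card : ℝ) * ∑ i, r i ^ 2) :=
          mul_le_mul_of_nonneg_left hii hS2
      _ = (∑ i, r i ^ 2) ^ 2 * K.card := by ring
  calc 2 * ∑ i, r i ^ 2 = (K.card : ℝ) * (2 * ((∑ i, r i ^ 2) / K.card)) := by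
        field_simp
    _ ≤ (K.card : ℝ) * (2 * ((∑ i, r i ^ 2) ^ 2 / (∑ i, r i) ^ 2)) :=
        mul_le_mul_of_nonneg_left (by linarith) hK0.le
    _ ≤ (K.card : ℝ) * ((∑ i, r i ^ 3) / (∑ i, r i) + (∑ i, r i ^ 2) ^ 2 / (∑ i, r i) ^ 2) :=
        mul_le_mul_of_nonneg_left hmain hK0.le

variable {Λ : Type*} [Fintype Λ] [DecidableEq Λ]

/-- The insertion field vanishes on `T` itself. [folklore] -/
theorem field_eq_zero_of_mem (ψ : TensorIndex Λ 2 → ℂ) (T : Finset Λ) {x : Λ} (hx : x ∈ T) :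
    field ψ T x = 0 :=
  Finset.sum_eq_zero fun _ _ => if_neg fun h => h.1 hx

/-- The insertion field of an entrywise nonnegative vector is nonnegative. [folklore] -/
theorem field_nonneg (ψ : TensorIndex Λ 2 → ℂ) (hψ : ∀ σ, 0 ≤ (ψ σ).re) (T : Finset Λ)
    (x : Λ) : 0 ≤ field ψ T x :=
  Finset.sum_nonneg fun y _ => by
    split_ifs
    · exact hψ _
    · exact le_rfl

/-- A single summand bounds the insertion field from below: `r^T_x ≥ Re ψ(1_{T ∪ {x,y}})` for
`x, y ∉ T`, `x ≠ y`. [folklore] -/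
theorem le_field (ψ : TensorIndex Λ 2 → ℂ) (hψ : ∀ σ, 0 ≤ (ψ σ).re) (T : Finset Λ) {x y : Λ}
    (hx : x ∉ T) (hy : y ∉ T) (hxy : x ≠ y) :
    (ψ (fun z => if z ∈ insert x (insert y T) then 0 else 1)).re ≤ field ψ T x := by
  rw [field]
  refine le_trans ?_ (Finset.single_le_sum (f := fun y' => if x ∉ T ∧ y' ∉ T ∧ x ≠ y' then
    (ψ (fun z => if z ∈ insert x (insert y' T) then 0 else 1)).re else 0) (fun y' _ => ?_)
    (Finset.mem_univ y))
  · rw [if_pos ⟨hx, hy, hxy⟩]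
  · split_ifs
    · exact hψ _
    · exact le_rfl

/-- **Floor for the crux functional, configuration by configuration**: for entrywise nonnegative `ψ`
and `|T| = N - 2 ≤ |Λ|`, `2‖r^T‖² ≤ (|Λ| - N + 2) · ‖r^T‖²Φ_T`. [folklore] -/
theorem K1_floor_field (ψ : TensorIndex Λ 2 → ℂ) (hψ : ∀ σ, 0 ≤ (ψ σ).re) (T : Finset Λ) :
    2 * K1rhs (field ψ T) ≤ ((Fintype.card Λ - T.card : ℕ) : ℝ) * K1lhs (field ψ T) := by
  have h := K1_floor (field ψ T) (field_nonneg ψ hψ T) Tᶜ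
    fun x hx => field_eq_zero_of_mem ψ T (by simpa using hx)
  rwa [Finset.card_compl] at h

/-- **Necessary size of the constant.** If the crux holds with constant `M`, then for every admissible
datum `(L, N, ψ)` whose insertion fields are not all zero,
`2L³ ≤ (L³ - N + 2) · M`, i.e. `M ≥ 2L³/(L³ - N + 2)` (`→ 2` at low filling, `→ 4` at half filling).
[folklore] -/
theorem const_lower_bound {M : ℝ} (hM : InsertionFieldDelocalisationAt M) (L : ℕ) [NeZero L]
    (hL : 2 ≤ L) (N : ℕ) (hN : 2 ≤ N) (hNL : 2 * N ≤ L ^ 3) (ψ : TensorIndex (TorusSite 3 L) 2 → ℂ)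
    (hsec : ψ ∈ spinZSector 1 ((N : ℝ) - (L : ℝ) ^ 3 / 2)) (hne : ψ ≠ 0)
    (heig : (xyTorus 3 L 1).mulVec ψ =
      ((lowestEnergyInSector 1 (xyTorus 3 L 1) ((N : ℝ) - (L : ℝ) ^ 3 / 2) : ℝ) : ℂ) • ψ)
    (hnn : ∀ σ, 0 ≤ (ψ σ).re ∧ (ψ σ).im = 0)
    (hpos : 0 < ∑ T ∈ (Finset.univ : Finset (TorusSite 3 L)).powersetCard (N - 2), K1rhs (field ψ T)) :
    2 * (L : ℝ) ^ 3 ≤ ((L : ℝ) ^ 3 - N + 2) * M := by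
  have key := hM L hL N hN hNL ψ hsec hne heig hnn
  rw [K1Ineq] at key
  set A := ∑ T ∈ (Finset.univ : Finset (TorusSite 3 L)).powersetCard (N - 2), K1lhs (field ψ T)
  set B := ∑ T ∈ (Finset.univ : Finset (TorusSite 3 L)).powersetCard (N - 2), K1rhs (field ψ T)
  -- the floor summed over `T`: `2B ≤ (L³ - N + 2) A`
  have hKN : ∀ T ∈ (Finset.univ : Finset (TorusSite 3 L)).powersetCard (N - 2),
      ((Fintype.card (TorusSite 3 L) - T.card : ℕ) : ℝ) = (L : ℝ) ^ 3 - N + 2 := by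
    intro T hT
    rw [(Finset.mem_powersetCard.mp hT).2, card_torusSite 3 L]
    have h1 : N - 2 ≤ L ^ 3 := by omega
    rw [Nat.cast_sub h1, Nat.cast_sub (by omega : 2 ≤ N)]
    push_cast
    ring
  have hfloor : 2 * B ≤ ((L : ℝ) ^ 3 - N + 2) * A := by
    have h : ∀ T ∈ (Finset.univ : Finset (TorusSite 3 L)).powersetCard (N - 2),
        2 * K1rhs (field ψ T) ≤ ((L : ℝ) ^ 3 - N + 2) * K1lhs (field ψ T) := by
      intro T hT
      rw [← hKN T hT]
      exact K1_floor_field ψ (fun σ => (hnn σ).1) T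
    calc 2 * B = ∑ T ∈ (Finset.univ : Finset (TorusSite 3 L)).powersetCard (N - 2),
          2 * K1rhs (field ψ T) := by rw [Finset.mul_sum]
      _ ≤ ∑ T ∈ (Finset.univ : Finset (TorusSite 3 L)).powersetCard (N - 2),
          ((L : ℝ) ^ 3 - N + 2) * K1lhs (field ψ T) := Finset.sum_le_sum h
      _ = ((L : ℝ) ^ 3 - N + 2) * A := by rw [← Finset.mul_sum]
  have hK0 : (0 : ℝ) < (L : ℝ) ^ 3 - N + 2 := by
    have : (2 * N : ℝ) ≤ (L : ℝ) ^ 3 := by exact_mod_cast hNL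
    linarith
  have hL0 : (0 : ℝ) < (L : ℝ) ^ 3 := by positivity
  -- `2 L³ B ≤ K L³ A ≤ K M B`, divide by `B > 0`
  have h1 : 2 * (L : ℝ) ^ 3 * B ≤ ((L : ℝ) ^ 3 - N + 2) * M * B :=
    calc 2 * (L : ℝ) ^ 3 * B = (L : ℝ) ^ 3 * (2 * B) := by ring
      _ ≤ (L : ℝ) ^ 3 * (((L : ℝ) ^ 3 - N + 2) * A) := mul_le_mul_of_nonneg_left hfloor hL0.le
      _ = ((L : ℝ) ^ 3 - N + 2) * ((L : ℝ) ^ 3 * A) := by ring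
      _ ≤ ((L : ℝ) ^ 3 - N + 2) * (M * B) := mul_le_mul_of_nonneg_left key hK0.le
      _ = ((L : ℝ) ^ 3 - N + 2) * M * B := by ring
  exact le_of_mul_le_mul_right h1 hpos

/-- The magnetisation of an occupation indicator: `Σ_x (½ - (1_S)_x) = |S| - |Λ|/2`. [folklore] -/
theorem magnetisation_ind (S : Finset Λ) :
    (∑ x : Λ, (((1 : ℕ) : ℂ) / 2 - (((if x ∈ S then (0 : Fin 2) else 1 : Fin 2) : ℕ) : ℂ))) =
      (S.card : ℂ) - (Fintype.card Λ : ℂ) / 2 := by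
  have hsummand : ∀ x : Λ, ((1 : ℕ) : ℂ) / 2 - (((if x ∈ S then (0 : Fin 2) else 1 : Fin 2) : ℕ) : ℂ) =
      if x ∈ S then (1 / 2 : ℂ) else (-(1 / 2) : ℂ) := by
    intro x
    by_cases hx : x ∈ S
    · simp [hx]
    · simp [hx]; ring
  rw [Finset.sum_congr rfl fun x _ => hsummand x, Finset.sum_ite, Finset.sum_const, Finset.sum_const,
    Finset.filter_mem_eq_inter, Finset.univ_inter]
  have hc : (Finset.univ.filter fun x => x ∉ S) = Sᶜ := by
    ext x; simp [Finset.mem_compl]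
  rw [hc, Finset.card_compl, nsmul_eq_mul, nsmul_eq_mul, Nat.cast_sub (Finset.card_le_univ S)]
  ring

/-- Every configuration is the indicator of its occupied set `{x | σ_x = 0}`. [folklore] -/
theorem ind_filter_eq (σ : TensorIndex Λ 2) :
    (fun z => if z ∈ Finset.univ.filter (fun x => σ x = 0) then (0 : Fin 2) else 1) = σ := by
  funext z
  simp only [Finset.mem_filter, Finset.mem_univ, true_and]
  generalize σ z = a
  fin_cases a <;> simp

/-- **A nonzero nonnegative sector vector has a charged `N`-set**: some `S` with `|S| = N` and
`Re ψ(1_S) > 0`. [folklore] -/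
theorem exists_occSet_pos (ψ : TensorIndex Λ 2 → ℂ) (N : ℕ) (Msec : ℝ)
    (hMsec : Msec = (N : ℝ) - (Fintype.card Λ : ℝ) / 2) (hsec : ψ ∈ spinZSector 1 Msec)
    (hne : ψ ≠ 0) (hnn : ∀ σ, 0 ≤ (ψ σ).re ∧ (ψ σ).im = 0) :
    ∃ S : Finset Λ, S.card = N ∧ 0 < (ψ (fun z => if z ∈ S then 0 else 1)).re := by
  obtain ⟨σ, hσ⟩ : ∃ σ, ψ σ ≠ 0 := Function.ne_iff.mp hne
  refine ⟨Finset.univ.filter fun x => σ x = 0, ?_, ?_⟩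
  · have hmag := (LiebMattis.mem_spinZSector_iff 1 Msec ψ).mp hsec σ hσ
    rw [← ind_filter_eq σ, magnetisation_ind, hMsec] at hmag
    have h : ((Finset.univ.filter fun x => σ x = 0).card : ℂ) = (N : ℂ) := by
      have := hmag
      push_cast at this
      linear_combination this
    exact_mod_cast h
  · rw [ind_filter_eq σ]
    rcases (hnn σ).1.eq_or_lt with h | h
    · exact absurd (Complex.ext h.symm (hnn σ).2) hσ
    · exact h

/-- **The `ω`-weights of an admissible vector are not all zero**: for a nonzero nonnegative sector-`N`
vector (`N ≥ 2`), `Σ_T ‖r^T‖² > 0` (take `T = S ∖ {x,y}` for a charged `N`-set `S ∋ x, y`). [folklore] -/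
theorem sum_K1rhs_pos (ψ : TensorIndex Λ 2 → ℂ) (N : ℕ) (hN : 2 ≤ N) (Msec : ℝ)
    (hMsec : Msec = (N : ℝ) - (Fintype.card Λ : ℝ) / 2) (hsec : ψ ∈ spinZSector 1 Msec)
    (hne : ψ ≠ 0) (hnn : ∀ σ, 0 ≤ (ψ σ).re ∧ (ψ σ).im = 0) :
    0 < ∑ T ∈ (Finset.univ : Finset Λ).powersetCard (N - 2), K1rhs (field ψ T) := by
  obtain ⟨S, hS, hpos⟩ := exists_occSet_pos ψ N Msec hMsec hsec hne hnn
  have h1S : 1 < S.card := by omega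
  obtain ⟨x, hx, y, hy, hxy⟩ := Finset.one_lt_card.mp h1S
  set T := (S.erase x).erase y with hT
  have hyx : y ∈ S.erase x := Finset.mem_erase.mpr ⟨Ne.symm hxy, hy⟩
  have hTS : insert x (insert y T) = S := by
    rw [hT, Finset.insert_erase hyx, Finset.insert_erase hx]
  have hxT : x ∉ T := by simp [hT]
  have hyT : y ∉ T := by simp [hT]
  have hTcard : T.card = N - 2 := by
    rw [hT, Finset.card_erase_of_mem hyx, Finset.card_erase_of_mem hx, hS]
    omega
  have hTmem : T ∈ (Finset.univ : Finset Λ).powersetCard (N - 2) :=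
    Finset.mem_powersetCard.mpr ⟨Finset.subset_univ T, hTcard⟩
  have hfield : 0 < field ψ T x := by
    refine lt_of_lt_of_le ?_ (le_field ψ (fun σ => (hnn σ).1) T hxT hyT hxy)
    rwa [hTS]
  have hK1 : 0 < K1rhs (field ψ T) := by
    rw [K1rhs]
    refine lt_of_lt_of_le (pow_pos hfield 2) ?_
    exact Finset.single_le_sum (f := fun x' => field ψ T x' ^ 2) (fun x' _ => sq_nonneg _)
      (Finset.mem_univ x)
  refine lt_of_lt_of_le hK1 ?_
  exact Finset.single_le_sum (f := fun T' => K1rhs (field ψ T'))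
    (fun T' _ => Finset.sum_nonneg fun x' _ => sq_nonneg _) hTmem

/-- **The constant cannot be below `4` (tightness at half filling, unconditional).** Any constant `M`
for which the crux holds satisfies `M ≥ 4`: at `N = L³/2` (nonnegative sector ground vectors exist by
`exists_nonneg_sectorGroundState_xyTorus`) the floor gives `M ≥ 4L³/(L³ + 4)` for every even `L`.
Consequently the coherence constant the route can deliver is `c = 1/max(M,1) ≤ ¼`, and every
strengthening of the crux to a constant `M < 4` is FALSE: `¬ InsertionFieldDelocalisationAt M`.
[folklore] -/
theorem four_le_const {M : ℝ} (hM : InsertionFieldDelocalisationAt M) : 4 ≤ M := by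
  by_contra hlt
  push Not at hlt
  obtain ⟨L, hL2, hLM⟩ := exists_side_gt (M / (8 - 2 * M))
  haveI : NeZero (2 * L) := ⟨by omega⟩
  have h2L : 2 ≤ 2 * L := by omega
  obtain ⟨ψ, hne, hnn, hsec, heig⟩ := exists_nonneg_sectorGroundState_xyTorus 3 (2 * L) (4 * L ^ 3)
    (by rw [mul_pow]; omega)
  have hN2 : 2 ≤ 4 * L ^ 3 := by
    have : 1 ≤ L ^ 3 := Nat.one_le_pow _ _ (by omega)
    omega
  have hNL : 2 * (4 * L ^ 3) ≤ (2 * L) ^ 3 := by rw [mul_pow]; omega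
  have hpos := sum_K1rhs_pos ψ (4 * L ^ 3) hN2 _ (by rw [card_torusSite 3 (2 * L)]; push_cast; ring) hsec hne hnn
  have key := const_lower_bound hM (2 * L) h2L (4 * L ^ 3) hN2 hNL ψ hsec hne heig hnn hpos
  push_cast at key
  have hden : 0 < 8 - 2 * M := by linarith
  have hL' : M < (L : ℝ) ^ 3 * (8 - 2 * M) := (div_lt_iff₀ hden).mp hLM
  set X := (L : ℝ) ^ 3 with hX
  have hX0 : 0 < X := by positivity
  nlinarith [key, hL', hX0, hlt]

/-- **The trivial ceiling** `‖r‖²Φ(r) ≤ 2‖r‖²` for `r ≥ 0`: `Σr³ ≤ (Σr)(Σr²)` and `Σr² ≤ (Σr)²`.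
[folklore] -/
theorem K1_ceiling (r : ι → ℝ) (hr : ∀ i, 0 ≤ r i) : K1lhs r ≤ 2 * K1rhs r := by
  rw [K1lhs, K1rhs]
  have hR : 0 ≤ ∑ i, r i := Finset.sum_nonneg fun i _ => hr i
  have hle : ∀ i, r i ≤ ∑ j, r j := fun i =>
    Finset.single_le_sum (f := r) (fun j _ => hr j) (Finset.mem_univ i)
  have h3 : ∑ i, r i ^ 3 ≤ (∑ i, r i) * ∑ i, r i ^ 2 := by
    rw [Finset.mul_sum]
    refine Finset.sum_le_sum fun i _ => ?_
    calc r i ^ 3 = r i * r i ^ 2 := by ring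
      _ ≤ (∑ j, r j) * r i ^ 2 := mul_le_mul_of_nonneg_right (hle i) (sq_nonneg _)
  have h2 : ∑ i, r i ^ 2 ≤ (∑ i, r i) ^ 2 := by
    calc ∑ i, r i ^ 2 = ∑ i, r i * r i := Finset.sum_congr rfl fun i _ => by ring
      _ ≤ ∑ i, r i * ∑ j, r j := Finset.sum_le_sum fun i _ => mul_le_mul_of_nonneg_left (hle i) (hr i)
      _ = (∑ i, r i) ^ 2 := by rw [← Finset.sum_mul]; ring
  have hS2 : 0 ≤ ∑ i, r i ^ 2 := Finset.sum_nonneg fun i _ => sq_nonneg (r i)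
  by_cases hR0 : ∑ i, r i = 0
  · simp [hR0]
    positivity
  have hRpos : 0 < ∑ i, r i := lt_of_le_of_ne hR (Ne.symm hR0)
  have t1 : (∑ i, r i ^ 3) / (∑ i, r i) ≤ ∑ i, r i ^ 2 := by
    rw [div_le_iff₀ hRpos]
    linarith [h3]
  have t2 : (∑ i, r i ^ 2) ^ 2 / (∑ i, r i) ^ 2 ≤ ∑ i, r i ^ 2 := by
    rw [div_le_iff₀ (by positivity)]
    calc (∑ i, r i ^ 2) ^ 2 = (∑ i, r i ^ 2) * ∑ i, r i ^ 2 := by ring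
      _ ≤ (∑ i, r i ^ 2) * (∑ i, r i) ^ 2 := mul_le_mul_of_nonneg_left h2 hS2
  linarith

/-- **Only the thermodynamic limit is at stake**: for each fixed `L` the crux inequality holds with the
constant `M = 2L³`, for EVERY entrywise nonnegative vector (no eigen-equation, no sector needed).
Hence every restriction of the crux to finitely many `L` is true, and `Q(L,N) ≤ 2L³`. [folklore] -/
theorem K1Ineq_two_mul_cube (L : ℕ) [NeZero L] (N : ℕ) (ψ : TensorIndex (TorusSite 3 L) 2 → ℂ)
    (hψ : ∀ σ, 0 ≤ (ψ σ).re) : K1Ineq (2 * (L : ℝ) ^ 3) L N ψ := by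
  rw [K1Ineq]
  calc (L : ℝ) ^ 3 * ∑ T ∈ (Finset.univ : Finset (TorusSite 3 L)).powersetCard (N - 2), K1lhs (field ψ T)
      ≤ (L : ℝ) ^ 3 * ∑ T ∈ (Finset.univ : Finset (TorusSite 3 L)).powersetCard (N - 2),
          2 * K1rhs (field ψ T) :=
        mul_le_mul_of_nonneg_left
          (Finset.sum_le_sum fun T _ => K1_ceiling (field ψ T) (field_nonneg ψ hψ T)) (by positivity)
    _ = 2 * (L : ℝ) ^ 3 * ∑ T ∈ (Finset.univ : Finset (TorusSite 3 L)).powersetCard (N - 2),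
          K1rhs (field ψ T) := by
        rw [← Finset.mul_sum]
        ring

/-- The crux restricted to sides `L ≤ L₀` is TRUE (constant `2L₀³`). [folklore] -/
theorem insertionFieldDelocalisation_bounded_sides (L₀ : ℕ) :
    ∃ M : ℝ, ∀ (L : ℕ) [NeZero L], L ≤ L₀ → ∀ N : ℕ,
      ∀ ψ : TensorIndex (TorusSite 3 L) 2 → ℂ, (∀ σ, 0 ≤ (ψ σ).re ∧ (ψ σ).im = 0) →
        K1Ineq M L N ψ := by
  refine ⟨2 * (L₀ : ℝ) ^ 3, fun L _ hL N ψ hψ => ?_⟩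
  have h := K1Ineq_two_mul_cube L N ψ fun σ => (hψ σ).1
  rw [K1Ineq] at h ⊢
  refine h.trans (mul_le_mul_of_nonneg_right ?_ (Finset.sum_nonneg fun T _ =>
    Finset.sum_nonneg fun x _ => sq_nonneg _))
  have : (L : ℝ) ≤ L₀ := by exact_mod_cast hL
  have hL0 : (0 : ℝ) ≤ L := by positivity
  nlinarith [pow_le_pow_left₀ hL0 this 3]

/-- **Refuted strengthening**: the crux with any explicit constant `M < 4` (e.g. the flat-field value
`2`, or `3`) is false. [folklore] -/
theorem not_insertionFieldDelocalisationAt_of_lt_four {M : ℝ} (hM : M < 4) :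
    ¬ InsertionFieldDelocalisationAt M :=
  fun h => absurd (four_le_const h) (not_le.mpr hM)

end Tightness


end Summit.AtomisticToContinuum.BoseEinsteinCondensation.Theorems.InsertionFieldDelocalisation.Negative
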